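/-
Copyright (c) 2026 the pub-hodgecm-mathlib formalisation cell (harness21).  Prover seat hodgecm-mathlib-R90-C133-p02 (g2), Track B ∕ R90-TF, h413 = `stmt-HodgeConjecture-24833`,
R90-TF section S8 «ContSpec-n½» (S8 dealer R90-CS-plan (g3) S8-R202 «β2 = the (W1) ⇒ (W1′) BRIDGE», K2E1-p12 (g5)'s census `R90/S8/CENSUS-beta-KFiniteExchange.K2E1-p12-g5.md`
e0e795eb9e56dae0 + ★ β1 p864039): the `K`-FINITE EXCHANGE — every residue class of a `K_max`-FINITE section is a finite sum of residue classes of sections lying in IRREDUCIBLE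
finite-dimensional `K_max`-stable spaces of sections (Weyl's unitarian trick on `K_max`), so the `K_max`-finite density letter (W1) implies the irreducible-span density letter (W1′) of
★ p863995 `hADM_of_letters`.
-/
import Summits.HodgeConjecture.HodgeConjecture.Theorems.R90S8ResGMidSectionBoundedU3              -- ★ p864054: `hSUM_of_unitary`; brings ★ p863995 (`hADM_of_letters`), ★ p863949 (β′ graph), ★ p863816 (`isIrreducible_of_equiv`), ★ p863302, ★ D1
import Summits.HodgeConjecture.HodgeConjecture.Theorems.R90S8KModuleInvariantFormComplementU3     -- ★ β1 p864039 (K2E1-p12): `exists_stable_compl_of_invariant_form`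
import Literature.NumberTheory.Automorphic.GKModulesProofs                                     -- ★ `exists_minimal_stable_submodule`, `isIrreducible_of_intertwiningMap_injective`
import Mathlib.MeasureTheory.Measure.Haar.Basic                                                -- Mathlib `MeasureTheory.Measure.haar`
import Mathlib.MeasureTheory.Group.Integral                                                    -- Mathlib `MeasureTheory.integral_mul_left_eq_self`
import Mathlib.MeasureTheory.Integral.Bochner.ContinuousLinearMap                              -- Mathlib `integral_ofReal`
import Mathlib.MeasureTheory.Function.LocallyIntegrable                                        -- Mathlib `ContinuousOn.integrableOn_compact`
import HarnessLib

/-!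
# S8 (R)′ road, letter (ADM) step (β2) — `R90S8ResGMidAtomKFiniteExchangeU3`: THE `K`-FINITE EXCHANGE (WEYL'S UNITARIAN TRICK ON `K_max`) — residue classes of `K_max`-finite sections are
# finite sums of residue classes of sections in irreducible finite-dimensional `K_max`-stable spaces; the bridge (W1) ⇒ (W1′)

Track B ∕ R90-TF, crux h413 = `stmt-HodgeConjecture-24833`, route of record `HCCMUnconditional`; cell `hodgecm-mathlib`, R90-TF section S8 «ContSpec-n½ ∕ ResidualSpectrum», socket (R)
(B ED. 7 :337) ← ★ `res_midBlock_le_residual_of_letters' (hDISC) …` ← ★ p863816 `hDISC_of_inv_of_admissible (hINV) (hADM)` ← ★ p863995 `hADM_of_letters (hSUM) (hW1′)` ← **THIS FILE: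
`hW1prime_of_kFinite (hsum) (hW1) : hW1′`**, so that the density letter of record may be the `K_max`-FINITE one, (W1).  THEOREMS ONLY (no `def`, no `instance`, no `notation`, no
named-fact hypothesis, no `sorry`; default heartbeats); lane `--supports stmt-HodgeConjecture-24833 --as helper` (count-neutral).  CLOSES NO SOCKET.

THE MATHEMATICS ([BrockerTomDieck1985] II (1.7), (1.9); [WallachRRG1] §1.4.6–1.4.7; [MoeglinWaldspurger1995] I.2.17, V.3.13; [Serre1977] §1.3).  `ρ_K := r|_{K_max}` on the sections
`G(𝔸) → ℂ`.  §1 (generic algebra, any group): if a finite-dimensional `ρ`-stable `S` carries a `ρ`-invariant sesquilinear form definite on `S`, then `S` is the span of its IRREDUCIBLE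
stable subspaces (★ β1 `exists_stable_compl_of_invariant_form` + minimal stable subspaces ★ `exists_minimal_stable_submodule`, induction on `dim S`).  §2 (the unitarian trick on
`K_max`): for a finite-dimensional `ρ_K`-stable space `S` of CONTINUOUS level-free PAIR-SECTIONS, `B a b := ∫_{K_max} conj (a x⁻¹) · b x⁻¹ ∂haar` is sesquilinear, `ρ_K`-invariant
(LEFT invariance of `haar` on the compact group `K_max` ★ — the inversion turns `r(k)` into left translation) and definite (`∫ |a|² = 0`, Haar positive on opens, continuity ⇒ `a|_{K_max} =
0` ⇒ `a = 0` by the pair-section law and the CM adelic Iwasawa decomposition ★).  §3: for `(φ, f)` in the residue graph `Gr` (★ (β′), modulo `hsum`) with `S_φ := span ρ_K(K_max)φ`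
finite-dimensional: `S_φ ≤ dom Res` (the domain is a `K_max`-stable submodule ★), §1–§2 on `↥S_φ` split `φ = Σ φᵢ` with `φᵢ` in irreducible stable finite-dimensional `Sᵢ ≤ S_φ`, and
`Res` is linear on its domain, so `f = Res φ = Σ Res φᵢ` with each `Res φᵢ` a (W1′)-generator (irreducibility transported along `Submodule.equivSubtypeMap`, ★ `isIrreducible_of_equiv`). Hence `cl span G_fin ≤ cl span G_irr`: **(W1) ⇒ (W1′)**.
* §1 `le_of_irreducibles_le_of_invariant_form` (generic).  * §2 `continuous_of_mem_span_rightTranslation`, **`exists_invariant_definite_form_kMax`**.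
* §3 **`mem_span_irrGenerators_of_kFinite`**, **`hW1prime_of_kFinite (hsum) (hW1)`** (one `(L, μ, ξ, μω)`); the ∀-closed corollaries `hADM_of_kFinite` ∕ `hDISC_of_inv_of_kFinite` (hDISC =
  ★ ∘ {(INV), (W1) `K_max`-finite density, `hχu` unitarity}) follow in the sequel `R90S8ResGMidAtomAdmissibleOfKFiniteU3`.
HONEST LABEL: HC_CM is proved only modulo the 7 printed citations (2 remaining named inputs: hLiu418 = `stmt-HodgeConjecture-24832`, h413 = `stmt-HodgeConjecture-24833`) until
rung 0 closes; REL ≠ ★ ≠ BUILT; (W1) is L and UNPRINTED AS TYPED at exotic (non-`K`-finite) generators (audit note J-S8-W1); pays no socket; count-neutral.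

## References
* [BrockerTomDieck1985] T. Bröcker, T. tom Dieck, *Representations of Compact Lie Groups*, GTM 98 (1985), II (1.7), (1.9); [Serre1977] J.-P. Serre, *Linear Representations of Finite Groups* (1977), §1.3.
* [WallachRRG1] N. R. Wallach, *Real Reductive Groups I* (1988), §1.4.6–1.4.7; [MoeglinWaldspurger1995] C. Mœglin, J.-L. Waldspurger, *Spectral Decomposition and Eisenstein Series* (1995), I.2.17, V.3.13.
-/

set_option autoImplicit false
set_option linter.dupNamespace false  -- the mandated namespace `…HodgeConjecture.HodgeConjecture.R90.S8` (LEAD #1 L1) repeats the summit's segment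

noncomputable section

open MeasureTheory Measure Set Filter Topology NumberField ContRepresentation
open Literature.NumberTheory Literature.NumberTheory.Automorphic Literature.NumberTheory.Automorphic.UnitaryGroup Literature.NumberTheory.GaloisRepresentations AdelicGroupData
open Literature.NumberTheory.Automorphic.Arthur2013.Leaves.TECR Literature.NumberTheory.Rogawski1990
open Summit.HodgeConjecture.HodgeConjecture.Cruxes.H413.K2E1BorelEisensteinU
open Summit.HodgeConjecture.HodgeConjecture.Cruxes.H413.K2E1CharacterEisensteinU3PairDefs
open Summit.HodgeConjecture.HodgeConjecture.Cruxes.H413.K2E1ChiSectionSpaceU3PairDefs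
open scoped ENNReal NNReal ComplexConjugate

namespace Summit.HodgeConjecture.HodgeConjecture.R90.S8

/-! ## §1 Generic: a finite-dimensional stable space with an invariant definite form is the span of its irreducible stable subspaces -/

/-- **COMPLETE REDUCIBILITY FROM AN INVARIANT DEFINITE FORM** (any group `K`): if `ρ` carries a sesquilinear form `B` with `B (ρ k a) (ρ k b) = B a b`, definite on the finite-dimensional
stable `S`, then `S` lies in every submodule `P` that contains each finite-dimensional stable `U ≤ S` on which `ρ` is irreducible (i.e. `S` is the span of its irreducible stable
subspaces) — induction on `dim S`: a minimal non-zero stable `W₀ ≤ S` (★ `exists_minimal_stable_submodule`) is irreducible (★ `isIrreducible_of_intertwiningMap_injective`), ★ β1 gives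
a stable complement `C`, `dim C < dim S`. [cite: BrockerTomDieck1985, II (1.9)] [cite: Serre1977, §1.3 Thm. 1] -/
theorem le_of_irreducibles_le_of_invariant_form {K : Type*} [Group K] {V : Type*} [AddCommGroup V] [Module ℂ V] (ρ : Representation ℂ K V)
    (B : V →ₗ⋆[ℂ] V →ₗ[ℂ] ℂ) (hBinv : ∀ (k : K) (a b : V), B (ρ k a) (ρ k b) = B a b)
    (S : Submodule ℂ V) [FiniteDimensional ℂ S] (hS : ∀ k, ∀ v ∈ S, ρ k v ∈ S) (hBdef : ∀ a ∈ S, B a a = 0 → a = 0)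
    (P : Submodule ℂ V)
    (hP : ∀ (U : Submodule ℂ V) (hU : ∀ k, ∀ w ∈ U, ρ k w ∈ U), U ≤ S → FiniteDimensional ℂ ↥U →
      (Subrepresentation.toRepresentation (⟨U, hU⟩ : Subrepresentation ρ)).IsIrreducible → U ≤ P) :
    S ≤ P := by
  -- strong induction on `dim S′`, for all stable `S′ ≤ S`
  suffices h : ∀ (n : ℕ) (S' : Submodule ℂ V), S' ≤ S → (∀ k, ∀ v ∈ S', ρ k v ∈ S') → Module.finrank ℂ S' ≤ n → S' ≤ P from
    h _ S le_rfl hS le_rfl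
  intro n
  induction n with
  | zero =>
    intro S' hS'S _ hdim
    haveI : FiniteDimensional ℂ S' := Submodule.finiteDimensional_of_le hS'S
    rw [Nat.le_zero, Submodule.finrank_eq_zero] at hdim
    exact hdim ▸ bot_le
  | succ n ih =>
    intro S' hS'S hS' hdim
    haveI : FiniteDimensional ℂ S' := Submodule.finiteDimensional_of_le hS'S
    by_cases h0 : S' = ⊥
    · exact h0 ▸ bot_le
    -- a minimal non-zero stable `W₀ ≤ S′`, irreducible
    obtain ⟨W₀, hW₀S', hW₀ne, hW₀K, hW₀min⟩ := Literature.NumberTheory.Automorphic.exists_minimal_stable_submodule ρ S' h0 hS'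
    haveI : FiniteDimensional ℂ W₀ := Submodule.finiteDimensional_of_le (hW₀S'.trans hS'S)
    haveI : Nontrivial W₀ := (Submodule.nontrivial_iff_ne_bot).2 hW₀ne
    have hirr : (Subrepresentation.toRepresentation (⟨W₀, hW₀K⟩ : Subrepresentation ρ)).IsIrreducible := by
      refine Literature.NumberTheory.Automorphic.isIrreducible_of_intertwiningMap_injective ρ
        ({ toLinearMap := W₀.subtype, isIntertwining' := fun k => rfl } : (Subrepresentation.toRepresentation (⟨W₀, hW₀K⟩ : Subrepresentation ρ)).IntertwiningMap ρ)
        Subtype.val_injective fun U hU hUle => ?_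
      have hr : LinearMap.range (W₀.subtype) = W₀ := Submodule.range_subtype W₀
      change U ≤ LinearMap.range W₀.subtype at hUle
      change U = ⊥ ∨ U = LinearMap.range W₀.subtype
      rw [hr] at hUle ⊢
      exact hW₀min U hU hUle
    -- a stable complement `C` of `W₀` in `S′`
    obtain ⟨C, hCS', hCK, hdisj, hsup⟩ := exists_stable_compl_of_invariant_form ρ B hBinv hS' (fun a ha => hBdef a (hS'S ha)) hW₀S' hW₀K
    haveI : FiniteDimensional ℂ C := Submodule.finiteDimensional_of_le (hCS'.trans hS'S)
    have hdimC : Module.finrank ℂ C ≤ n := by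
      have h1 := Submodule.finrank_sup_add_finrank_inf_eq W₀ C
      rw [hdisj, finrank_bot, add_zero, hsup] at h1
      have h2 : 0 < Module.finrank ℂ W₀ := Module.finrank_pos
      omega
    rw [← hsup]
    exact sup_le (hP W₀ hW₀K (hW₀S'.trans hS'S) inferInstance hirr) (ih C (hCS'.trans hS'S) hCK hdimC)

/-! ## §2 The unitarian trick on `K_max`: an invariant definite form on a finite-dimensional stable space of continuous level-free pair-sections -/

section Unitarian

variable (L : Type) [Field L] [NumberField L] [IsCMField L]
  (ξ : OneDimAutRepH L) (μω : HeckeCharacter L)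

/-- **Sections in the `K_max`-span of a continuous section are continuous** (right translates of a continuous function are continuous; spans preserve continuity). [folklore] -/
theorem continuous_of_mem_span_rightTranslation {φ : (quasiSplit (↥(maximalRealSubfield L)) L (IsCMField.complexConj L) 3).Adelic → ℂ} (hφc : Continuous φ)
    {ψ : (quasiSplit (↥(maximalRealSubfield L)) L (IsCMField.complexConj L) 3).Adelic → ℂ} (hψ : ψ ∈ Submodule.span ℂ (Set.range fun k : ↥((standardMaximalCompactGL 3 L).comap (adelicVal (↥(maximalRealSubfield L)) L (IsCMField.complexConj L) 3 ((StdForm.antidiagonal 3).over L)) :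
      Subgroup (quasiSplit (↥(maximalRealSubfield L)) L (IsCMField.complexConj L) 3).Adelic) => ((rightTranslation (quasiSplit (↥(maximalRealSubfield L)) L (IsCMField.complexConj L) 3)).comp ((standardMaximalCompactGL 3 L).comap (adelicVal (↥(maximalRealSubfield L)) L (IsCMField.complexConj L) 3 ((StdForm.antidiagonal 3).over L)) :
      Subgroup (quasiSplit (↥(maximalRealSubfield L)) L (IsCMField.complexConj L) 3).Adelic).subtype) k φ)) : Continuous ψ := by
  induction hψ using Submodule.span_induction with
  | mem x hx =>
    obtain ⟨k, rfl⟩ := hx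
    exact hφc.comp (continuous_id.mul continuous_const)
  | zero => exact continuous_const
  | add x y _ _ hx hy => exact hx.add hy
  | smul a x _ hx => exact hx.const_smul a

/-- **THE UNITARIAN TRICK ON `K_max`**: a finite-dimensional `r(K_max)`-stable space `S` of CONTINUOUS level-free PAIR-SECTIONS of the `φ_ξ`-block carries an `r(K_max)`-invariant
sesquilinear form, DEFINITE on `S` — `B a b := ∫_{K_max} conj (a x⁻¹) · b x⁻¹ ∂haar`: invariant by LEFT-invariance of the Haar measure of the compact group `K_max` (★
`isCompact_comap_adelicVal_standardMaximalCompactGL`), definite because a continuous section vanishing on `K_max` (Haar is positive on opens) vanishes identically (pair-section law + ★ CM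
adelic Iwasawa). [cite: BrockerTomDieck1985, II (1.7)] [cite: MoeglinWaldspurger1995, I.2.17] -/
theorem exists_invariant_definite_form_kMax (S : Submodule ℂ ((quasiSplit (↥(maximalRealSubfield L)) L (IsCMField.complexConj L) 3).Adelic → ℂ)) [FiniteDimensional ℂ ↥S]
    (hS : ∀ k : ↥((standardMaximalCompactGL 3 L).comap (adelicVal (↥(maximalRealSubfield L)) L (IsCMField.complexConj L) 3 ((StdForm.antidiagonal 3).over L)) :
      Subgroup (quasiSplit (↥(maximalRealSubfield L)) L (IsCMField.complexConj L) 3).Adelic), ∀ ψ ∈ S, ((rightTranslation (quasiSplit (↥(maximalRealSubfield L)) L (IsCMField.complexConj L) 3)).comp ((standardMaximalCompactGL 3 L).comap (adelicVal (↥(maximalRealSubfield L)) L (IsCMField.complexConj L) 3 ((StdForm.antidiagonal 3).over L)) :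
      Subgroup (quasiSplit (↥(maximalRealSubfield L)) L (IsCMField.complexConj L) 3).Adelic).subtype) k ψ ∈ S)
    (hSV : S ≤ chiSectionSpacePair (ξ.bcη⁻¹ * ξ.bcψ⁻¹ * μω) ξ.ψ (⊥ : Subgroup (quasiSplit (↥(maximalRealSubfield L)) L (IsCMField.complexConj L) 3).Adelic)
          ((1 : ↥(⊥ : Subgroup (quasiSplit (↥(maximalRealSubfield L)) L (IsCMField.complexConj L) 3).Adelic) →* ℂ) : ↥(⊥ : Subgroup (quasiSplit (↥(maximalRealSubfield L)) L (IsCMField.complexConj L) 3).Adelic) → ℂ))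
    (hSc : ∀ ψ ∈ S, Continuous ψ) :
    ∃ B : ↥S →ₗ⋆[ℂ] ↥S →ₗ[ℂ] ℂ,
      (∀ (k : ↥((standardMaximalCompactGL 3 L).comap (adelicVal (↥(maximalRealSubfield L)) L (IsCMField.complexConj L) 3 ((StdForm.antidiagonal 3).over L)) :
      Subgroup (quasiSplit (↥(maximalRealSubfield L)) L (IsCMField.complexConj L) 3).Adelic)) (a b : ↥S),
        B (Subrepresentation.toRepresentation (⟨S, hS⟩ : Subrepresentation ((rightTranslation (quasiSplit (↥(maximalRealSubfield L)) L (IsCMField.complexConj L) 3)).comp ((standardMaximalCompactGL 3 L).comap (adelicVal (↥(maximalRealSubfield L)) L (IsCMField.complexConj L) 3 ((StdForm.antidiagonal 3).over L)) :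
      Subgroup (quasiSplit (↥(maximalRealSubfield L)) L (IsCMField.complexConj L) 3).Adelic).subtype)) k a) (Subrepresentation.toRepresentation (⟨S, hS⟩ : Subrepresentation ((rightTranslation (quasiSplit (↥(maximalRealSubfield L)) L (IsCMField.complexConj L) 3)).comp ((standardMaximalCompactGL 3 L).comap (adelicVal (↥(maximalRealSubfield L)) L (IsCMField.complexConj L) 3 ((StdForm.antidiagonal 3).over L)) :
      Subgroup (quasiSplit (↥(maximalRealSubfield L)) L (IsCMField.complexConj L) 3).Adelic).subtype)) k b) = B a b) ∧
      ∀ a : ↥S, B a a = 0 → a = 0 := by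
  -- the compact group `K_max` and its Haar measure
  haveI := t2Space_adeleRing_of_numberField L
  haveI : T2Space (quasiSplit (↥(maximalRealSubfield L)) L (IsCMField.complexConj L) 3).Adelic := inferInstanceAs (T2Space (adelic (↥(maximalRealSubfield L)) L (IsCMField.complexConj L) 3 ((StdForm.antidiagonal 3).over L)))
  haveI : CompactSpace ↥((standardMaximalCompactGL 3 L).comap (adelicVal (↥(maximalRealSubfield L)) L (IsCMField.complexConj L) 3 ((StdForm.antidiagonal 3).over L)) :
      Subgroup (quasiSplit (↥(maximalRealSubfield L)) L (IsCMField.complexConj L) 3).Adelic) := isCompact_iff_compactSpace.1 isCompact_comap_adelicVal_standardMaximalCompactGL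
  letI : MeasurableSpace ↥((standardMaximalCompactGL 3 L).comap (adelicVal (↥(maximalRealSubfield L)) L (IsCMField.complexConj L) 3 ((StdForm.antidiagonal 3).over L)) :
      Subgroup (quasiSplit (↥(maximalRealSubfield L)) L (IsCMField.complexConj L) 3).Adelic) := borel _
  haveI : BorelSpace ↥((standardMaximalCompactGL 3 L).comap (adelicVal (↥(maximalRealSubfield L)) L (IsCMField.complexConj L) 3 ((StdForm.antidiagonal 3).over L)) :
      Subgroup (quasiSplit (↥(maximalRealSubfield L)) L (IsCMField.complexConj L) 3).Adelic) := ⟨rfl⟩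
  -- the integrand and its integrability
  have hcont : ∀ a : ↥S, Continuous fun x : ↥((standardMaximalCompactGL 3 L).comap (adelicVal (↥(maximalRealSubfield L)) L (IsCMField.complexConj L) 3 ((StdForm.antidiagonal 3).over L)) :
      Subgroup (quasiSplit (↥(maximalRealSubfield L)) L (IsCMField.complexConj L) 3).Adelic) => (a : (quasiSplit (↥(maximalRealSubfield L)) L (IsCMField.complexConj L) 3).Adelic → ℂ) ((x⁻¹ : ↥((standardMaximalCompactGL 3 L).comap (adelicVal (↥(maximalRealSubfield L)) L (IsCMField.complexConj L) 3 ((StdForm.antidiagonal 3).over L)) :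
      Subgroup (quasiSplit (↥(maximalRealSubfield L)) L (IsCMField.complexConj L) 3).Adelic)) : (quasiSplit (↥(maximalRealSubfield L)) L (IsCMField.complexConj L) 3).Adelic) := fun a =>
    (hSc a a.2).comp (continuous_subtype_val.comp continuous_inv)
  have hint : ∀ a b : ↥S, Integrable (fun x : ↥((standardMaximalCompactGL 3 L).comap (adelicVal (↥(maximalRealSubfield L)) L (IsCMField.complexConj L) 3 ((StdForm.antidiagonal 3).over L)) :
      Subgroup (quasiSplit (↥(maximalRealSubfield L)) L (IsCMField.complexConj L) 3).Adelic) => conj ((a : (quasiSplit (↥(maximalRealSubfield L)) L (IsCMField.complexConj L) 3).Adelic → ℂ) ((x⁻¹ : ↥((standardMaximalCompactGL 3 L).comap (adelicVal (↥(maximalRealSubfield L)) L (IsCMField.complexConj L) 3 ((StdForm.antidiagonal 3).over L)) :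
      Subgroup (quasiSplit (↥(maximalRealSubfield L)) L (IsCMField.complexConj L) 3).Adelic)) : (quasiSplit (↥(maximalRealSubfield L)) L (IsCMField.complexConj L) 3).Adelic)) * (b : (quasiSplit (↥(maximalRealSubfield L)) L (IsCMField.complexConj L) 3).Adelic → ℂ) ((x⁻¹ : ↥((standardMaximalCompactGL 3 L).comap (adelicVal (↥(maximalRealSubfield L)) L (IsCMField.complexConj L) 3 ((StdForm.antidiagonal 3).over L)) :
      Subgroup (quasiSplit (↥(maximalRealSubfield L)) L (IsCMField.complexConj L) 3).Adelic)) : (quasiSplit (↥(maximalRealSubfield L)) L (IsCMField.complexConj L) 3).Adelic)) Measure.haar := fun a b =>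
    MeasureTheory.integrableOn_univ.1 ((((Complex.continuous_conj.comp (hcont a)).mul (hcont b)).continuousOn).integrableOn_compact isCompact_univ)
  refine ⟨LinearMap.mk₂'ₛₗ (starRingEnd ℂ) (RingHom.id ℂ)
      (fun a b : ↥S => ∫ x : ↥((standardMaximalCompactGL 3 L).comap (adelicVal (↥(maximalRealSubfield L)) L (IsCMField.complexConj L) 3 ((StdForm.antidiagonal 3).over L)) :
      Subgroup (quasiSplit (↥(maximalRealSubfield L)) L (IsCMField.complexConj L) 3).Adelic), conj ((a : (quasiSplit (↥(maximalRealSubfield L)) L (IsCMField.complexConj L) 3).Adelic → ℂ) ((x⁻¹ : ↥((standardMaximalCompactGL 3 L).comap (adelicVal (↥(maximalRealSubfield L)) L (IsCMField.complexConj L) 3 ((StdForm.antidiagonal 3).over L)) :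
      Subgroup (quasiSplit (↥(maximalRealSubfield L)) L (IsCMField.complexConj L) 3).Adelic)) : (quasiSplit (↥(maximalRealSubfield L)) L (IsCMField.complexConj L) 3).Adelic)) * (b : (quasiSplit (↥(maximalRealSubfield L)) L (IsCMField.complexConj L) 3).Adelic → ℂ) ((x⁻¹ : ↥((standardMaximalCompactGL 3 L).comap (adelicVal (↥(maximalRealSubfield L)) L (IsCMField.complexConj L) 3 ((StdForm.antidiagonal 3).over L)) :
      Subgroup (quasiSplit (↥(maximalRealSubfield L)) L (IsCMField.complexConj L) 3).Adelic)) : (quasiSplit (↥(maximalRealSubfield L)) L (IsCMField.complexConj L) 3).Adelic) ∂Measure.haar)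
      (fun a a' b => ?_) (fun c a b => ?_) (fun a b b' => ?_) (fun c a b => ?_), fun k a b => ?_, fun a ha => ?_⟩
  · rw [← integral_add (hint a b) (hint a' b)]
    exact integral_congr_ae (Eventually.of_forall fun x => by simp only [Submodule.coe_add, Pi.add_apply, map_add, add_mul])
  · rw [smul_eq_mul, ← integral_const_mul]
    exact integral_congr_ae (Eventually.of_forall fun x => by simp only [Submodule.coe_smul, Pi.smul_apply, smul_eq_mul, map_mul, starRingEnd_apply, mul_assoc])
  · rw [← integral_add (hint a b) (hint a b')]
    exact integral_congr_ae (Eventually.of_forall fun x => by simp only [Submodule.coe_add, Pi.add_apply, mul_add])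
  · rw [RingHom.id_apply, smul_eq_mul, ← integral_const_mul]
    exact integral_congr_ae (Eventually.of_forall fun x => by simp only [Submodule.coe_smul, Pi.smul_apply, smul_eq_mul]; ring)
  · -- invariance: `x ↦ k⁻¹ x` and left-invariance of `haar`
    simp only [LinearMap.mk₂'ₛₗ_apply]
    have h := MeasureTheory.integral_mul_left_eq_self
      (fun x : ↥((standardMaximalCompactGL 3 L).comap (adelicVal (↥(maximalRealSubfield L)) L (IsCMField.complexConj L) 3 ((StdForm.antidiagonal 3).over L)) :
      Subgroup (quasiSplit (↥(maximalRealSubfield L)) L (IsCMField.complexConj L) 3).Adelic) => conj ((a : (quasiSplit (↥(maximalRealSubfield L)) L (IsCMField.complexConj L) 3).Adelic → ℂ) ((x⁻¹ : ↥((standardMaximalCompactGL 3 L).comap (adelicVal (↥(maximalRealSubfield L)) L (IsCMField.complexConj L) 3 ((StdForm.antidiagonal 3).over L)) :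
      Subgroup (quasiSplit (↥(maximalRealSubfield L)) L (IsCMField.complexConj L) 3).Adelic)) : (quasiSplit (↥(maximalRealSubfield L)) L (IsCMField.complexConj L) 3).Adelic)) * (b : (quasiSplit (↥(maximalRealSubfield L)) L (IsCMField.complexConj L) 3).Adelic → ℂ) ((x⁻¹ : ↥((standardMaximalCompactGL 3 L).comap (adelicVal (↥(maximalRealSubfield L)) L (IsCMField.complexConj L) 3 ((StdForm.antidiagonal 3).over L)) :
      Subgroup (quasiSplit (↥(maximalRealSubfield L)) L (IsCMField.complexConj L) 3).Adelic)) : (quasiSplit (↥(maximalRealSubfield L)) L (IsCMField.complexConj L) 3).Adelic)) k⁻¹ (μ := (Measure.haar : Measure ↥((standardMaximalCompactGL 3 L).comap (adelicVal (↥(maximalRealSubfield L)) L (IsCMField.complexConj L) 3 ((StdForm.antidiagonal 3).over L)) :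
      Subgroup (quasiSplit (↥(maximalRealSubfield L)) L (IsCMField.complexConj L) 3).Adelic)))
    refine Eq.trans (integral_congr_ae (Eventually.of_forall fun x => ?_)) h
    show conj (((a : (quasiSplit (↥(maximalRealSubfield L)) L (IsCMField.complexConj L) 3).Adelic → ℂ) (((x⁻¹ : ↥((standardMaximalCompactGL 3 L).comap (adelicVal (↥(maximalRealSubfield L)) L (IsCMField.complexConj L) 3 ((StdForm.antidiagonal 3).over L)) :
      Subgroup (quasiSplit (↥(maximalRealSubfield L)) L (IsCMField.complexConj L) 3).Adelic)) : (quasiSplit (↥(maximalRealSubfield L)) L (IsCMField.complexConj L) 3).Adelic) * ((k : ↥((standardMaximalCompactGL 3 L).comap (adelicVal (↥(maximalRealSubfield L)) L (IsCMField.complexConj L) 3 ((StdForm.antidiagonal 3).over L)) :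
      Subgroup (quasiSplit (↥(maximalRealSubfield L)) L (IsCMField.complexConj L) 3).Adelic)) : (quasiSplit (↥(maximalRealSubfield L)) L (IsCMField.complexConj L) 3).Adelic)))) * (b : (quasiSplit (↥(maximalRealSubfield L)) L (IsCMField.complexConj L) 3).Adelic → ℂ) (((x⁻¹ : ↥((standardMaximalCompactGL 3 L).comap (adelicVal (↥(maximalRealSubfield L)) L (IsCMField.complexConj L) 3 ((StdForm.antidiagonal 3).over L)) :
      Subgroup (quasiSplit (↥(maximalRealSubfield L)) L (IsCMField.complexConj L) 3).Adelic)) : (quasiSplit (↥(maximalRealSubfield L)) L (IsCMField.complexConj L) 3).Adelic) * ((k : ↥((standardMaximalCompactGL 3 L).comap (adelicVal (↥(maximalRealSubfield L)) L (IsCMField.complexConj L) 3 ((StdForm.antidiagonal 3).over L)) :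
      Subgroup (quasiSplit (↥(maximalRealSubfield L)) L (IsCMField.complexConj L) 3).Adelic)) : (quasiSplit (↥(maximalRealSubfield L)) L (IsCMField.complexConj L) 3).Adelic)) =
      conj ((a : (quasiSplit (↥(maximalRealSubfield L)) L (IsCMField.complexConj L) 3).Adelic → ℂ) (((k⁻¹ * x)⁻¹ : ↥((standardMaximalCompactGL 3 L).comap (adelicVal (↥(maximalRealSubfield L)) L (IsCMField.complexConj L) 3 ((StdForm.antidiagonal 3).over L)) :
      Subgroup (quasiSplit (↥(maximalRealSubfield L)) L (IsCMField.complexConj L) 3).Adelic)) : (quasiSplit (↥(maximalRealSubfield L)) L (IsCMField.complexConj L) 3).Adelic)) * (b : (quasiSplit (↥(maximalRealSubfield L)) L (IsCMField.complexConj L) 3).Adelic → ℂ) (((k⁻¹ * x)⁻¹ : ↥((standardMaximalCompactGL 3 L).comap (adelicVal (↥(maximalRealSubfield L)) L (IsCMField.complexConj L) 3 ((StdForm.antidiagonal 3).over L)) :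
      Subgroup (quasiSplit (↥(maximalRealSubfield L)) L (IsCMField.complexConj L) 3).Adelic)) : (quasiSplit (↥(maximalRealSubfield L)) L (IsCMField.complexConj L) 3).Adelic)
    rw [mul_inv_rev, inv_inv, Subgroup.coe_mul]
  · -- definiteness
    simp only [LinearMap.mk₂'ₛₗ_apply] at ha
    have hsq : (∫ x : ↥((standardMaximalCompactGL 3 L).comap (adelicVal (↥(maximalRealSubfield L)) L (IsCMField.complexConj L) 3 ((StdForm.antidiagonal 3).over L)) :
      Subgroup (quasiSplit (↥(maximalRealSubfield L)) L (IsCMField.complexConj L) 3).Adelic), conj ((a : (quasiSplit (↥(maximalRealSubfield L)) L (IsCMField.complexConj L) 3).Adelic → ℂ) ((x⁻¹ : ↥((standardMaximalCompactGL 3 L).comap (adelicVal (↥(maximalRealSubfield L)) L (IsCMField.complexConj L) 3 ((StdForm.antidiagonal 3).over L)) :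
      Subgroup (quasiSplit (↥(maximalRealSubfield L)) L (IsCMField.complexConj L) 3).Adelic)) : (quasiSplit (↥(maximalRealSubfield L)) L (IsCMField.complexConj L) 3).Adelic)) * (a : (quasiSplit (↥(maximalRealSubfield L)) L (IsCMField.complexConj L) 3).Adelic → ℂ) ((x⁻¹ : ↥((standardMaximalCompactGL 3 L).comap (adelicVal (↥(maximalRealSubfield L)) L (IsCMField.complexConj L) 3 ((StdForm.antidiagonal 3).over L)) :
      Subgroup (quasiSplit (↥(maximalRealSubfield L)) L (IsCMField.complexConj L) 3).Adelic)) : (quasiSplit (↥(maximalRealSubfield L)) L (IsCMField.complexConj L) 3).Adelic) ∂Measure.haar) =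
        ((∫ x : ↥((standardMaximalCompactGL 3 L).comap (adelicVal (↥(maximalRealSubfield L)) L (IsCMField.complexConj L) 3 ((StdForm.antidiagonal 3).over L)) :
      Subgroup (quasiSplit (↥(maximalRealSubfield L)) L (IsCMField.complexConj L) 3).Adelic), ‖(a : (quasiSplit (↥(maximalRealSubfield L)) L (IsCMField.complexConj L) 3).Adelic → ℂ) ((x⁻¹ : ↥((standardMaximalCompactGL 3 L).comap (adelicVal (↥(maximalRealSubfield L)) L (IsCMField.complexConj L) 3 ((StdForm.antidiagonal 3).over L)) :
      Subgroup (quasiSplit (↥(maximalRealSubfield L)) L (IsCMField.complexConj L) 3).Adelic)) : (quasiSplit (↥(maximalRealSubfield L)) L (IsCMField.complexConj L) 3).Adelic)‖ ^ 2 ∂Measure.haar : ℝ) : ℂ) := by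
      rw [← integral_complex_ofReal]
      exact integral_congr_ae (Eventually.of_forall fun x => by simp only [Complex.conj_mul', Complex.ofReal_pow])
    rw [hsq, Complex.ofReal_eq_zero] at ha
    have hnn : 0 ≤ fun x : ↥((standardMaximalCompactGL 3 L).comap (adelicVal (↥(maximalRealSubfield L)) L (IsCMField.complexConj L) 3 ((StdForm.antidiagonal 3).over L)) :
      Subgroup (quasiSplit (↥(maximalRealSubfield L)) L (IsCMField.complexConj L) 3).Adelic) => ‖(a : (quasiSplit (↥(maximalRealSubfield L)) L (IsCMField.complexConj L) 3).Adelic → ℂ) ((x⁻¹ : ↥((standardMaximalCompactGL 3 L).comap (adelicVal (↥(maximalRealSubfield L)) L (IsCMField.complexConj L) 3 ((StdForm.antidiagonal 3).over L)) :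
      Subgroup (quasiSplit (↥(maximalRealSubfield L)) L (IsCMField.complexConj L) 3).Adelic)) : (quasiSplit (↥(maximalRealSubfield L)) L (IsCMField.complexConj L) 3).Adelic)‖ ^ 2 := fun x => sq_nonneg _
    have hint2 : Integrable (fun x : ↥((standardMaximalCompactGL 3 L).comap (adelicVal (↥(maximalRealSubfield L)) L (IsCMField.complexConj L) 3 ((StdForm.antidiagonal 3).over L)) :
      Subgroup (quasiSplit (↥(maximalRealSubfield L)) L (IsCMField.complexConj L) 3).Adelic) => ‖(a : (quasiSplit (↥(maximalRealSubfield L)) L (IsCMField.complexConj L) 3).Adelic → ℂ) ((x⁻¹ : ↥((standardMaximalCompactGL 3 L).comap (adelicVal (↥(maximalRealSubfield L)) L (IsCMField.complexConj L) 3 ((StdForm.antidiagonal 3).over L)) :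
      Subgroup (quasiSplit (↥(maximalRealSubfield L)) L (IsCMField.complexConj L) 3).Adelic)) : (quasiSplit (↥(maximalRealSubfield L)) L (IsCMField.complexConj L) 3).Adelic)‖ ^ 2) Measure.haar :=
      MeasureTheory.integrableOn_univ.1 ((((hcont a).norm.pow 2).continuousOn).integrableOn_compact isCompact_univ)
    have hae := (integral_eq_zero_iff_of_nonneg hnn hint2).1 ha
    have hzero : (fun x : ↥((standardMaximalCompactGL 3 L).comap (adelicVal (↥(maximalRealSubfield L)) L (IsCMField.complexConj L) 3 ((StdForm.antidiagonal 3).over L)) :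
      Subgroup (quasiSplit (↥(maximalRealSubfield L)) L (IsCMField.complexConj L) 3).Adelic) => ‖(a : (quasiSplit (↥(maximalRealSubfield L)) L (IsCMField.complexConj L) 3).Adelic → ℂ) ((x⁻¹ : ↥((standardMaximalCompactGL 3 L).comap (adelicVal (↥(maximalRealSubfield L)) L (IsCMField.complexConj L) 3 ((StdForm.antidiagonal 3).over L)) :
      Subgroup (quasiSplit (↥(maximalRealSubfield L)) L (IsCMField.complexConj L) 3).Adelic)) : (quasiSplit (↥(maximalRealSubfield L)) L (IsCMField.complexConj L) 3).Adelic)‖ ^ 2) = fun _ => 0 :=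
      (Continuous.ae_eq_iff_eq Measure.haar ((hcont a).norm.pow 2) continuous_const).1 hae
    -- `a` vanishes on `K_max`, hence everywhere (pair-section law + Iwasawa)
    have hK : ∀ k : ↥((standardMaximalCompactGL 3 L).comap (adelicVal (↥(maximalRealSubfield L)) L (IsCMField.complexConj L) 3 ((StdForm.antidiagonal 3).over L)) :
      Subgroup (quasiSplit (↥(maximalRealSubfield L)) L (IsCMField.complexConj L) 3).Adelic), (a : (quasiSplit (↥(maximalRealSubfield L)) L (IsCMField.complexConj L) 3).Adelic → ℂ) (k : (quasiSplit (↥(maximalRealSubfield L)) L (IsCMField.complexConj L) 3).Adelic) = 0 := fun k => by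
      have h := congrFun hzero k⁻¹
      exact norm_eq_zero.1 ((pow_eq_zero_iff two_ne_zero).1 (by simpa only [inv_inv] using h))
    refine Subtype.ext (funext fun g => ?_)
    obtain ⟨b, hb, k, hk, rfl⟩ := exists_mem_borelAdelic_mul_mem_standardMaximalCompactGL_cm_three L g
    rw [isChiSectionPair_of_mem (hSV a.2) b hb k, hK ⟨k, Subgroup.mem_comap.2 hk⟩, mul_zero]
    rfl

end Unitarian

/-! ## §3 The bridge: residue classes of `K_max`-finite sections lie in the span of the (W1′)-generators; (W1) ⇒ (W1′) -/

section Bridge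

variable (L : Type) [Field L] [NumberField L] [IsCMField L]
  (μ : Measure (quasiSplit (↥(maximalRealSubfield L)) L (IsCMField.complexConj L) 3).automorphicQuotient)
  [(quasiSplit (↥(maximalRealSubfield L)) L (IsCMField.complexConj L) 3).IsAutomorphicMeasure μ]
  (ξ : OneDimAutRepH L) (μω : HeckeCharacter L)

/-- **THE `K`-FINITE EXCHANGE**: for `(φ, f)` in the residue relation (`REL`, ★ (β′)) with `φ` `K_max`-FINITE, `f` lies in the SPAN of the (W1′)-generators (residue classes of sections in
irreducible finite-dimensional `K_max`-stable spaces).  `S_φ := span r(K_max)φ` is finite-dimensional, stable, made of continuous pair-sections, contained in the domain of `Res` (★ (β′));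
§2 + §1 split `φ = Σ φᵢ` along irreducible stable `Sᵢ ≤ S_φ`; `Res` is linear; irreducibility is transported to `Sᵢ ↪ sections` along `Submodule.equivSubtypeMap` (★ `isIrreducible_of_equiv`).
[cite: BrockerTomDieck1985, II (1.9)] [cite: MoeglinWaldspurger1995, I.2.17, V.3.13] [cite: WallachRRG1, §1.4.7] -/
theorem mem_span_irrGenerators_of_kFinite
    (hsum : ∀ φ ∈ chiSectionSpacePair (ξ.bcη⁻¹ * ξ.bcψ⁻¹ * μω) ξ.ψ (⊥ : Subgroup (quasiSplit (↥(maximalRealSubfield L)) L (IsCMField.complexConj L) 3).Adelic)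
          ((1 : ↥(⊥ : Subgroup (quasiSplit (↥(maximalRealSubfield L)) L (IsCMField.complexConj L) 3).Adelic) →* ℂ) : ↥(⊥ : Subgroup (quasiSplit (↥(maximalRealSubfield L)) L (IsCMField.complexConj L) 3).Adelic) → ℂ),
      Continuous φ → ∀ z : ℂ, 2 < z.re → ∀ g : (quasiSplit (↥(maximalRealSubfield L)) L (IsCMField.complexConj L) 3).Adelic,
      Summable fun q : Quotient (MulAction.orbitRel ↥(borelU ((IsCMField.complexConj L : L ≃ₐ[↥(maximalRealSubfield L)] L) : L →+* L) ((StdForm.antidiagonal 3).over L)) ↥(unitaryGroupOfForm ((IsCMField.complexConj L : L ≃ₐ[↥(maximalRealSubfield L)] L) : L →+* L) ((StdForm.antidiagonal 3).over L))) =>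
        ‖flatSectionU φ z ((quasiSplit (↥(maximalRealSubfield L)) L (IsCMField.complexConj L) 3).toAdelic (Quotient.out q : ↥(unitaryGroupOfForm ((IsCMField.complexConj L : L ≃ₐ[↥(maximalRealSubfield L)] L) : L →+* L) ((StdForm.antidiagonal 3).over L))) * g)‖)
    {φ : (quasiSplit (↥(maximalRealSubfield L)) L (IsCMField.complexConj L) 3).Adelic → ℂ} {f : (quasiSplit (↥(maximalRealSubfield L)) L (IsCMField.complexConj L) 3).L2 μ}
    (hrel : (φ ∈ chiSectionSpacePair (ξ.bcη⁻¹ * ξ.bcψ⁻¹ * μω) ξ.ψ (⊥ : Subgroup (quasiSplit (↥(maximalRealSubfield L)) L (IsCMField.complexConj L) 3).Adelic)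
          ((1 : ↥(⊥ : Subgroup (quasiSplit (↥(maximalRealSubfield L)) L (IsCMField.complexConj L) 3).Adelic) →* ℂ) : ↥(⊥ : Subgroup (quasiSplit (↥(maximalRealSubfield L)) L (IsCMField.complexConj L) 3).Adelic) → ℂ) ∧ Continuous φ ∧
      ∃ (Ec : ℂ → (quasiSplit (↥(maximalRealSubfield L)) L (IsCMField.complexConj L) 3).Adelic → ℂ) (Sp : Finset ℂ)
        (_ : ∀ s ∈ Sp, s.im = 0 ∧ 1 < s.re ∧ s.re ≤ 2)
        (_ : ∀ g, DifferentiableOn ℂ (fun z => Ec z g) ({z : ℂ | 1 < z.re} \ (↑Sp : Set ℂ)))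
        (_ : ∀ z : ℂ, 2 < z.re → Ec z = eisensteinSeriesU (flatSectionU φ z))
        (Fp : (quasiSplit (↥(maximalRealSubfield L)) L (IsCMField.complexConj L) 3).Adelic → ℂ → ℂ)
        (_ : ∀ g, AnalyticAt ℂ (Fp g) ((3 : ℂ) / 2))
        (_ : ∀ g, Fp g =ᶠ[𝓝[≠] ((3 : ℂ) / 2)] fun z => (z - (3 : ℂ) / 2) * Ec z g),
        (f : (quasiSplit (↥(maximalRealSubfield L)) L (IsCMField.complexConj L) 3).automorphicQuotient → ℂ) =ᵐ[μ] (fun x : (quasiSplit (↥(maximalRealSubfield L)) L (IsCMField.complexConj L) 3).automorphicQuotient => Fp (Quotient.out (x : ((quasiSplit (↥(maximalRealSubfield L)) L (IsCMField.complexConj L) 3).Adelic ⧸ (quasiSplit (↥(maximalRealSubfield L)) L (IsCMField.complexConj L) 3).quotientSubgroup)))⁻¹ ((3 : ℂ) / 2))))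
    (hfin : FiniteDimensional ℂ ↥(Submodule.span ℂ (Set.range fun k : ↥((standardMaximalCompactGL 3 L).comap (adelicVal (↥(maximalRealSubfield L)) L (IsCMField.complexConj L) 3 ((StdForm.antidiagonal 3).over L)) :
      Subgroup (quasiSplit (↥(maximalRealSubfield L)) L (IsCMField.complexConj L) 3).Adelic) => ((rightTranslation (quasiSplit (↥(maximalRealSubfield L)) L (IsCMField.complexConj L) 3)).comp ((standardMaximalCompactGL 3 L).comap (adelicVal (↥(maximalRealSubfield L)) L (IsCMField.complexConj L) 3 ((StdForm.antidiagonal 3).over L)) :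
      Subgroup (quasiSplit (↥(maximalRealSubfield L)) L (IsCMField.complexConj L) 3).Adelic).subtype) k φ))) :
    f ∈ Submodule.span ℂ {f : (quasiSplit (↥(maximalRealSubfield L)) L (IsCMField.complexConj L) 3).L2 μ | ∃ φ : (quasiSplit (↥(maximalRealSubfield L)) L (IsCMField.complexConj L) 3).Adelic → ℂ, (φ ∈ chiSectionSpacePair (ξ.bcη⁻¹ * ξ.bcψ⁻¹ * μω) ξ.ψ (⊥ : Subgroup (quasiSplit (↥(maximalRealSubfield L)) L (IsCMField.complexConj L) 3).Adelic)
          ((1 : ↥(⊥ : Subgroup (quasiSplit (↥(maximalRealSubfield L)) L (IsCMField.complexConj L) 3).Adelic) →* ℂ) : ↥(⊥ : Subgroup (quasiSplit (↥(maximalRealSubfield L)) L (IsCMField.complexConj L) 3).Adelic) → ℂ) ∧ Continuous φ ∧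
          ∃ (Ec : ℂ → (quasiSplit (↥(maximalRealSubfield L)) L (IsCMField.complexConj L) 3).Adelic → ℂ) (Sp : Finset ℂ)
            (_ : ∀ s ∈ Sp, s.im = 0 ∧ 1 < s.re ∧ s.re ≤ 2)
            (_ : ∀ g, DifferentiableOn ℂ (fun z => Ec z g) ({z : ℂ | 1 < z.re} \ (↑Sp : Set ℂ)))
            (_ : ∀ z : ℂ, 2 < z.re → Ec z = eisensteinSeriesU (flatSectionU φ z))
            (Fp : (quasiSplit (↥(maximalRealSubfield L)) L (IsCMField.complexConj L) 3).Adelic → ℂ → ℂ)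
            (_ : ∀ g, AnalyticAt ℂ (Fp g) ((3 : ℂ) / 2))
            (_ : ∀ g, Fp g =ᶠ[𝓝[≠] ((3 : ℂ) / 2)] fun z => (z - (3 : ℂ) / 2) * Ec z g),
            (f : (quasiSplit (↥(maximalRealSubfield L)) L (IsCMField.complexConj L) 3).automorphicQuotient → ℂ) =ᵐ[μ] (fun x : (quasiSplit (↥(maximalRealSubfield L)) L (IsCMField.complexConj L) 3).automorphicQuotient => Fp (Quotient.out (x : ((quasiSplit (↥(maximalRealSubfield L)) L (IsCMField.complexConj L) 3).Adelic ⧸ (quasiSplit (↥(maximalRealSubfield L)) L (IsCMField.complexConj L) 3).quotientSubgroup)))⁻¹ ((3 : ℂ) / 2))) ∧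
          ∃ (S : Submodule ℂ ((quasiSplit (↥(maximalRealSubfield L)) L (IsCMField.complexConj L) 3).Adelic → ℂ)) (hS : ∀ k : ↥((standardMaximalCompactGL 3 L).comap (adelicVal (↥(maximalRealSubfield L)) L (IsCMField.complexConj L) 3 ((StdForm.antidiagonal 3).over L)) :
      Subgroup (quasiSplit (↥(maximalRealSubfield L)) L (IsCMField.complexConj L) 3).Adelic), ∀ ψ ∈ S, ((rightTranslation (quasiSplit (↥(maximalRealSubfield L)) L (IsCMField.complexConj L) 3)).comp ((standardMaximalCompactGL 3 L).comap (adelicVal (↥(maximalRealSubfield L)) L (IsCMField.complexConj L) 3 ((StdForm.antidiagonal 3).over L)) :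
      Subgroup (quasiSplit (↥(maximalRealSubfield L)) L (IsCMField.complexConj L) 3).Adelic).subtype) k ψ ∈ S),
            φ ∈ S ∧ FiniteDimensional ℂ ↥S ∧ (Subrepresentation.toRepresentation (⟨S, hS⟩ : Subrepresentation ((rightTranslation (quasiSplit (↥(maximalRealSubfield L)) L (IsCMField.complexConj L) 3)).comp ((standardMaximalCompactGL 3 L).comap (adelicVal (↥(maximalRealSubfield L)) L (IsCMField.complexConj L) 3 ((StdForm.antidiagonal 3).over L)) :
      Subgroup (quasiSplit (↥(maximalRealSubfield L)) L (IsCMField.complexConj L) 3).Adelic).subtype))).IsIrreducible} := by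
  obtain ⟨Gr, hGr⟩ := exists_midResidueGraph_bot L μ ξ μω hsum
  have hp : (φ, f) ∈ Gr := (hGr _).2 hrel
  -- `S := span r(K_max) φ`: finite-dimensional, stable, inside the domain of `Res`, made of continuous pair-sections
  let S : Submodule ℂ ((quasiSplit (↥(maximalRealSubfield L)) L (IsCMField.complexConj L) 3).Adelic → ℂ) := Submodule.span ℂ (Set.range fun k : ↥((standardMaximalCompactGL 3 L).comap (adelicVal (↥(maximalRealSubfield L)) L (IsCMField.complexConj L) 3 ((StdForm.antidiagonal 3).over L)) :
      Subgroup (quasiSplit (↥(maximalRealSubfield L)) L (IsCMField.complexConj L) 3).Adelic) => ((rightTranslation (quasiSplit (↥(maximalRealSubfield L)) L (IsCMField.complexConj L) 3)).comp ((standardMaximalCompactGL 3 L).comap (adelicVal (↥(maximalRealSubfield L)) L (IsCMField.complexConj L) 3 ((StdForm.antidiagonal 3).over L)) :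
      Subgroup (quasiSplit (↥(maximalRealSubfield L)) L (IsCMField.complexConj L) 3).Adelic).subtype) k φ)
  haveI : FiniteDimensional ℂ ↥S := hfin
  have hφS : φ ∈ S := Submodule.subset_span ⟨1, by show ((rightTranslation (quasiSplit (↥(maximalRealSubfield L)) L (IsCMField.complexConj L) 3)).comp ((standardMaximalCompactGL 3 L).comap (adelicVal (↥(maximalRealSubfield L)) L (IsCMField.complexConj L) 3 ((StdForm.antidiagonal 3).over L)) :
      Subgroup (quasiSplit (↥(maximalRealSubfield L)) L (IsCMField.complexConj L) 3).Adelic).subtype) 1 φ = φ; rw [map_one]; rfl⟩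
  have hS : ∀ k : ↥((standardMaximalCompactGL 3 L).comap (adelicVal (↥(maximalRealSubfield L)) L (IsCMField.complexConj L) 3 ((StdForm.antidiagonal 3).over L)) :
      Subgroup (quasiSplit (↥(maximalRealSubfield L)) L (IsCMField.complexConj L) 3).Adelic), ∀ ψ ∈ S, ((rightTranslation (quasiSplit (↥(maximalRealSubfield L)) L (IsCMField.complexConj L) 3)).comp ((standardMaximalCompactGL 3 L).comap (adelicVal (↥(maximalRealSubfield L)) L (IsCMField.complexConj L) 3 ((StdForm.antidiagonal 3).over L)) :
      Subgroup (quasiSplit (↥(maximalRealSubfield L)) L (IsCMField.complexConj L) 3).Adelic).subtype) k ψ ∈ S := by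
    intro k ψ hψ
    induction hψ using Submodule.span_induction with
    | mem x hx =>
      obtain ⟨k', rfl⟩ := hx
      refine Submodule.subset_span ⟨k * k', ?_⟩; show ((rightTranslation (quasiSplit (↥(maximalRealSubfield L)) L (IsCMField.complexConj L) 3)).comp ((standardMaximalCompactGL 3 L).comap (adelicVal (↥(maximalRealSubfield L)) L (IsCMField.complexConj L) 3 ((StdForm.antidiagonal 3).over L)) :
      Subgroup (quasiSplit (↥(maximalRealSubfield L)) L (IsCMField.complexConj L) 3).Adelic).subtype) (k * k') φ = ((rightTranslation (quasiSplit (↥(maximalRealSubfield L)) L (IsCMField.complexConj L) 3)).comp ((standardMaximalCompactGL 3 L).comap (adelicVal (↥(maximalRealSubfield L)) L (IsCMField.complexConj L) 3 ((StdForm.antidiagonal 3).over L)) :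
      Subgroup (quasiSplit (↥(maximalRealSubfield L)) L (IsCMField.complexConj L) 3).Adelic).subtype) k (((rightTranslation (quasiSplit (↥(maximalRealSubfield L)) L (IsCMField.complexConj L) 3)).comp ((standardMaximalCompactGL 3 L).comap (adelicVal (↥(maximalRealSubfield L)) L (IsCMField.complexConj L) 3 ((StdForm.antidiagonal 3).over L)) :
      Subgroup (quasiSplit (↥(maximalRealSubfield L)) L (IsCMField.complexConj L) 3).Adelic).subtype) k' φ)
      rw [map_mul]; rfl
    | zero => rw [map_zero]; exact Submodule.zero_mem _
    | add x y _ _ hx hy => rw [map_add]; exact Submodule.add_mem _ hx hy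
    | smul a x _ hx => rw [map_smul]; exact Submodule.smul_mem _ a hx
  have hSD : S ≤ Gr.map (LinearMap.fst ℂ ((quasiSplit (↥(maximalRealSubfield L)) L (IsCMField.complexConj L) 3).Adelic → ℂ) ((quasiSplit (↥(maximalRealSubfield L)) L (IsCMField.complexConj L) 3).L2 μ)) := Submodule.span_le.2 (by
    rintro _ ⟨k, rfl⟩
    exact rightTranslation_mem_map_fst_midResidueGraph L μ ξ μω Gr hGr k.2 ⟨(φ, f), hp, rfl⟩)
  have hSV : S ≤ chiSectionSpacePair (ξ.bcη⁻¹ * ξ.bcψ⁻¹ * μω) ξ.ψ (⊥ : Subgroup (quasiSplit (↥(maximalRealSubfield L)) L (IsCMField.complexConj L) 3).Adelic)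
          ((1 : ↥(⊥ : Subgroup (quasiSplit (↥(maximalRealSubfield L)) L (IsCMField.complexConj L) 3).Adelic) →* ℂ) : ↥(⊥ : Subgroup (quasiSplit (↥(maximalRealSubfield L)) L (IsCMField.complexConj L) 3).Adelic) → ℂ) := fun ψ hψ => by
    obtain ⟨q, hq, hq1⟩ := hSD hψ
    exact hq1 ▸ ((hGr q).1 hq).1
  have hSc : ∀ ψ ∈ S, Continuous ψ := fun ψ hψ => continuous_of_mem_span_rightTranslation L hrel.2.1 hψ
  -- `Res|_S`, linear, with `Res φ = f`
  let ResS : ↥S →ₗ[ℂ] (quasiSplit (↥(maximalRealSubfield L)) L (IsCMField.complexConj L) 3).L2 μ := Gr.toLinearPMap.toFun ∘ₗ Submodule.inclusion hSD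
  have hResφ : ResS ⟨φ, hφS⟩ = f :=
    midResidueGraph_snd_eq_of_fst_eq L μ ξ μω Gr hGr _ (mem_midResidueGraph_toLinearPMap L μ ξ μω Gr hGr ⟨φ, hSD hφS⟩) _ hp rfl
  rw [← hResφ]
  -- the unitarian trick (§2) and complete reducibility (§1) on `↥S`, tested against `P := Res⁻¹ (span G_irr)`
  obtain ⟨B, hBinv, hBdef⟩ := exists_invariant_definite_form_kMax L ξ μω S hS hSV hSc
  refine le_of_irreducibles_le_of_invariant_form (Subrepresentation.toRepresentation (⟨S, hS⟩ : Subrepresentation ((rightTranslation (quasiSplit (↥(maximalRealSubfield L)) L (IsCMField.complexConj L) 3)).comp ((standardMaximalCompactGL 3 L).comap (adelicVal (↥(maximalRealSubfield L)) L (IsCMField.complexConj L) 3 ((StdForm.antidiagonal 3).over L)) :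
      Subgroup (quasiSplit (↥(maximalRealSubfield L)) L (IsCMField.complexConj L) 3).Adelic).subtype))) B hBinv ⊤
    (fun k v _ => Submodule.mem_top) (fun a _ => hBdef a) ((Submodule.span ℂ {f : (quasiSplit (↥(maximalRealSubfield L)) L (IsCMField.complexConj L) 3).L2 μ | ∃ φ : (quasiSplit (↥(maximalRealSubfield L)) L (IsCMField.complexConj L) 3).Adelic → ℂ, (φ ∈ chiSectionSpacePair (ξ.bcη⁻¹ * ξ.bcψ⁻¹ * μω) ξ.ψ (⊥ : Subgroup (quasiSplit (↥(maximalRealSubfield L)) L (IsCMField.complexConj L) 3).Adelic)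
          ((1 : ↥(⊥ : Subgroup (quasiSplit (↥(maximalRealSubfield L)) L (IsCMField.complexConj L) 3).Adelic) →* ℂ) : ↥(⊥ : Subgroup (quasiSplit (↥(maximalRealSubfield L)) L (IsCMField.complexConj L) 3).Adelic) → ℂ) ∧ Continuous φ ∧
          ∃ (Ec : ℂ → (quasiSplit (↥(maximalRealSubfield L)) L (IsCMField.complexConj L) 3).Adelic → ℂ) (Sp : Finset ℂ)
            (_ : ∀ s ∈ Sp, s.im = 0 ∧ 1 < s.re ∧ s.re ≤ 2)
            (_ : ∀ g, DifferentiableOn ℂ (fun z => Ec z g) ({z : ℂ | 1 < z.re} \ (↑Sp : Set ℂ)))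
            (_ : ∀ z : ℂ, 2 < z.re → Ec z = eisensteinSeriesU (flatSectionU φ z))
            (Fp : (quasiSplit (↥(maximalRealSubfield L)) L (IsCMField.complexConj L) 3).Adelic → ℂ → ℂ)
            (_ : ∀ g, AnalyticAt ℂ (Fp g) ((3 : ℂ) / 2))
            (_ : ∀ g, Fp g =ᶠ[𝓝[≠] ((3 : ℂ) / 2)] fun z => (z - (3 : ℂ) / 2) * Ec z g),
            (f : (quasiSplit (↥(maximalRealSubfield L)) L (IsCMField.complexConj L) 3).automorphicQuotient → ℂ) =ᵐ[μ] (fun x : (quasiSplit (↥(maximalRealSubfield L)) L (IsCMField.complexConj L) 3).automorphicQuotient => Fp (Quotient.out (x : ((quasiSplit (↥(maximalRealSubfield L)) L (IsCMField.complexConj L) 3).Adelic ⧸ (quasiSplit (↥(maximalRealSubfield L)) L (IsCMField.complexConj L) 3).quotientSubgroup)))⁻¹ ((3 : ℂ) / 2))) ∧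
          ∃ (S : Submodule ℂ ((quasiSplit (↥(maximalRealSubfield L)) L (IsCMField.complexConj L) 3).Adelic → ℂ)) (hS : ∀ k : ↥((standardMaximalCompactGL 3 L).comap (adelicVal (↥(maximalRealSubfield L)) L (IsCMField.complexConj L) 3 ((StdForm.antidiagonal 3).over L)) :
      Subgroup (quasiSplit (↥(maximalRealSubfield L)) L (IsCMField.complexConj L) 3).Adelic), ∀ ψ ∈ S, ((rightTranslation (quasiSplit (↥(maximalRealSubfield L)) L (IsCMField.complexConj L) 3)).comp ((standardMaximalCompactGL 3 L).comap (adelicVal (↥(maximalRealSubfield L)) L (IsCMField.complexConj L) 3 ((StdForm.antidiagonal 3).over L)) :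
      Subgroup (quasiSplit (↥(maximalRealSubfield L)) L (IsCMField.complexConj L) 3).Adelic).subtype) k ψ ∈ S),
            φ ∈ S ∧ FiniteDimensional ℂ ↥S ∧ (Subrepresentation.toRepresentation (⟨S, hS⟩ : Subrepresentation ((rightTranslation (quasiSplit (↥(maximalRealSubfield L)) L (IsCMField.complexConj L) 3)).comp ((standardMaximalCompactGL 3 L).comap (adelicVal (↥(maximalRealSubfield L)) L (IsCMField.complexConj L) 3 ((StdForm.antidiagonal 3).over L)) :
      Subgroup (quasiSplit (↥(maximalRealSubfield L)) L (IsCMField.complexConj L) 3).Adelic).subtype))).IsIrreducible}).comap ResS) (fun U hU _ hUfd hUirr => ?_) (Submodule.mem_top : (⟨φ, hφS⟩ : ↥S) ∈ (⊤ : Submodule ℂ ↥S))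
  -- an irreducible piece `U ≤ S` is mapped by `Res` into the (W1′)-generators
  intro x hxU
  haveI := hUfd
  have hS' : ∀ k : ↥((standardMaximalCompactGL 3 L).comap (adelicVal (↥(maximalRealSubfield L)) L (IsCMField.complexConj L) 3 ((StdForm.antidiagonal 3).over L)) :
      Subgroup (quasiSplit (↥(maximalRealSubfield L)) L (IsCMField.complexConj L) 3).Adelic), ∀ ψ ∈ U.map S.subtype, ((rightTranslation (quasiSplit (↥(maximalRealSubfield L)) L (IsCMField.complexConj L) 3)).comp ((standardMaximalCompactGL 3 L).comap (adelicVal (↥(maximalRealSubfield L)) L (IsCMField.complexConj L) 3 ((StdForm.antidiagonal 3).over L)) :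
      Subgroup (quasiSplit (↥(maximalRealSubfield L)) L (IsCMField.complexConj L) 3).Adelic).subtype) k ψ ∈ U.map S.subtype := by
    rintro k _ ⟨w, hw, rfl⟩
    exact ⟨_, hU k w hw, rfl⟩
  have hx' : ((x : (quasiSplit (↥(maximalRealSubfield L)) L (IsCMField.complexConj L) 3).Adelic → ℂ), ResS x) ∈ Gr := mem_midResidueGraph_toLinearPMap L μ ξ μω Gr hGr ⟨(x : (quasiSplit (↥(maximalRealSubfield L)) L (IsCMField.complexConj L) 3).Adelic → ℂ), hSD x.2⟩
  refine Submodule.subset_span ⟨(x : (quasiSplit (↥(maximalRealSubfield L)) L (IsCMField.complexConj L) 3).Adelic → ℂ), (hGr _).1 hx', U.map S.subtype, hS', ⟨x, hxU, rfl⟩, Module.Finite.map _ _, ?_⟩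
  exact isIrreducible_of_equiv (Representation.Equiv.mk (S.equivSubtypeMap U) fun k => LinearMap.ext fun w => Subtype.ext (by
    simp only [LinearMap.coe_comp, Function.comp_apply, LinearEquiv.coe_coe, Submodule.equivSubtypeMap_apply, LinearMap.domRestrict_apply, Submodule.subtype_apply]
    rfl)) hUirr

/-- **(W1) ⇒ (W1′)** (one `(L, μ, ξ, μω)`): the `K_max`-FINITE density letter «`A_⊥ ≤ cl span {f | ∃ φ, REL(φ, f) ∧ dim span r(K_max)φ < ∞}`» implies the (W1′) binder of ★ p863995 `hADM_of_letters`
(irreducible-span density), modulo `hsum`. [cite: MoeglinWaldspurger1995, I.2.17, V.3.13] [cite: BrockerTomDieck1985, II (1.9)] -/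
theorem hW1prime_of_kFinite
    (hsum : ∀ φ ∈ chiSectionSpacePair (ξ.bcη⁻¹ * ξ.bcψ⁻¹ * μω) ξ.ψ (⊥ : Subgroup (quasiSplit (↥(maximalRealSubfield L)) L (IsCMField.complexConj L) 3).Adelic)
          ((1 : ↥(⊥ : Subgroup (quasiSplit (↥(maximalRealSubfield L)) L (IsCMField.complexConj L) 3).Adelic) →* ℂ) : ↥(⊥ : Subgroup (quasiSplit (↥(maximalRealSubfield L)) L (IsCMField.complexConj L) 3).Adelic) → ℂ),
      Continuous φ → ∀ z : ℂ, 2 < z.re → ∀ g : (quasiSplit (↥(maximalRealSubfield L)) L (IsCMField.complexConj L) 3).Adelic,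
      Summable fun q : Quotient (MulAction.orbitRel ↥(borelU ((IsCMField.complexConj L : L ≃ₐ[↥(maximalRealSubfield L)] L) : L →+* L) ((StdForm.antidiagonal 3).over L)) ↥(unitaryGroupOfForm ((IsCMField.complexConj L : L ≃ₐ[↥(maximalRealSubfield L)] L) : L →+* L) ((StdForm.antidiagonal 3).over L))) =>
        ‖flatSectionU φ z ((quasiSplit (↥(maximalRealSubfield L)) L (IsCMField.complexConj L) 3).toAdelic (Quotient.out q : ↥(unitaryGroupOfForm ((IsCMField.complexConj L : L ≃ₐ[↥(maximalRealSubfield L)] L) : L →+* L) ((StdForm.antidiagonal 3).over L))) * g)‖)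
    (hW1 : resGMidAtom L μ ξ μω ⊥ 1 ≤ (Submodule.span ℂ {f : (quasiSplit (↥(maximalRealSubfield L)) L (IsCMField.complexConj L) 3).L2 μ | ∃ φ : (quasiSplit (↥(maximalRealSubfield L)) L (IsCMField.complexConj L) 3).Adelic → ℂ, (φ ∈ chiSectionSpacePair (ξ.bcη⁻¹ * ξ.bcψ⁻¹ * μω) ξ.ψ (⊥ : Subgroup (quasiSplit (↥(maximalRealSubfield L)) L (IsCMField.complexConj L) 3).Adelic)
          ((1 : ↥(⊥ : Subgroup (quasiSplit (↥(maximalRealSubfield L)) L (IsCMField.complexConj L) 3).Adelic) →* ℂ) : ↥(⊥ : Subgroup (quasiSplit (↥(maximalRealSubfield L)) L (IsCMField.complexConj L) 3).Adelic) → ℂ) ∧ Continuous φ ∧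
          ∃ (Ec : ℂ → (quasiSplit (↥(maximalRealSubfield L)) L (IsCMField.complexConj L) 3).Adelic → ℂ) (Sp : Finset ℂ)
            (_ : ∀ s ∈ Sp, s.im = 0 ∧ 1 < s.re ∧ s.re ≤ 2)
            (_ : ∀ g, DifferentiableOn ℂ (fun z => Ec z g) ({z : ℂ | 1 < z.re} \ (↑Sp : Set ℂ)))
            (_ : ∀ z : ℂ, 2 < z.re → Ec z = eisensteinSeriesU (flatSectionU φ z))
            (Fp : (quasiSplit (↥(maximalRealSubfield L)) L (IsCMField.complexConj L) 3).Adelic → ℂ → ℂ)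
            (_ : ∀ g, AnalyticAt ℂ (Fp g) ((3 : ℂ) / 2))
            (_ : ∀ g, Fp g =ᶠ[𝓝[≠] ((3 : ℂ) / 2)] fun z => (z - (3 : ℂ) / 2) * Ec z g),
            (f : (quasiSplit (↥(maximalRealSubfield L)) L (IsCMField.complexConj L) 3).automorphicQuotient → ℂ) =ᵐ[μ] (fun x : (quasiSplit (↥(maximalRealSubfield L)) L (IsCMField.complexConj L) 3).automorphicQuotient => Fp (Quotient.out (x : ((quasiSplit (↥(maximalRealSubfield L)) L (IsCMField.complexConj L) 3).Adelic ⧸ (quasiSplit (↥(maximalRealSubfield L)) L (IsCMField.complexConj L) 3).quotientSubgroup)))⁻¹ ((3 : ℂ) / 2))) ∧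
          FiniteDimensional ℂ ↥(Submodule.span ℂ (Set.range fun k : ↥((standardMaximalCompactGL 3 L).comap (adelicVal (↥(maximalRealSubfield L)) L (IsCMField.complexConj L) 3 ((StdForm.antidiagonal 3).over L)) :
      Subgroup (quasiSplit (↥(maximalRealSubfield L)) L (IsCMField.complexConj L) 3).Adelic) => ((rightTranslation (quasiSplit (↥(maximalRealSubfield L)) L (IsCMField.complexConj L) 3)).comp ((standardMaximalCompactGL 3 L).comap (adelicVal (↥(maximalRealSubfield L)) L (IsCMField.complexConj L) 3 ((StdForm.antidiagonal 3).over L)) :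
      Subgroup (quasiSplit (↥(maximalRealSubfield L)) L (IsCMField.complexConj L) 3).Adelic).subtype) k φ))}).topologicalClosure) :
    resGMidAtom L μ ξ μω ⊥ 1 ≤ (Submodule.span ℂ {f : (quasiSplit (↥(maximalRealSubfield L)) L (IsCMField.complexConj L) 3).L2 μ | ∃ φ : (quasiSplit (↥(maximalRealSubfield L)) L (IsCMField.complexConj L) 3).Adelic → ℂ, (φ ∈ chiSectionSpacePair (ξ.bcη⁻¹ * ξ.bcψ⁻¹ * μω) ξ.ψ (⊥ : Subgroup (quasiSplit (↥(maximalRealSubfield L)) L (IsCMField.complexConj L) 3).Adelic)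
          ((1 : ↥(⊥ : Subgroup (quasiSplit (↥(maximalRealSubfield L)) L (IsCMField.complexConj L) 3).Adelic) →* ℂ) : ↥(⊥ : Subgroup (quasiSplit (↥(maximalRealSubfield L)) L (IsCMField.complexConj L) 3).Adelic) → ℂ) ∧ Continuous φ ∧
          ∃ (Ec : ℂ → (quasiSplit (↥(maximalRealSubfield L)) L (IsCMField.complexConj L) 3).Adelic → ℂ) (Sp : Finset ℂ)
            (_ : ∀ s ∈ Sp, s.im = 0 ∧ 1 < s.re ∧ s.re ≤ 2)
            (_ : ∀ g, DifferentiableOn ℂ (fun z => Ec z g) ({z : ℂ | 1 < z.re} \ (↑Sp : Set ℂ)))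
            (_ : ∀ z : ℂ, 2 < z.re → Ec z = eisensteinSeriesU (flatSectionU φ z))
            (Fp : (quasiSplit (↥(maximalRealSubfield L)) L (IsCMField.complexConj L) 3).Adelic → ℂ → ℂ)
            (_ : ∀ g, AnalyticAt ℂ (Fp g) ((3 : ℂ) / 2))
            (_ : ∀ g, Fp g =ᶠ[𝓝[≠] ((3 : ℂ) / 2)] fun z => (z - (3 : ℂ) / 2) * Ec z g),
            (f : (quasiSplit (↥(maximalRealSubfield L)) L (IsCMField.complexConj L) 3).automorphicQuotient → ℂ) =ᵐ[μ] (fun x : (quasiSplit (↥(maximalRealSubfield L)) L (IsCMField.complexConj L) 3).automorphicQuotient => Fp (Quotient.out (x : ((quasiSplit (↥(maximalRealSubfield L)) L (IsCMField.complexConj L) 3).Adelic ⧸ (quasiSplit (↥(maximalRealSubfield L)) L (IsCMField.complexConj L) 3).quotientSubgroup)))⁻¹ ((3 : ℂ) / 2))) ∧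
          ∃ (S : Submodule ℂ ((quasiSplit (↥(maximalRealSubfield L)) L (IsCMField.complexConj L) 3).Adelic → ℂ)) (hS : ∀ k : ↥((standardMaximalCompactGL 3 L).comap (adelicVal (↥(maximalRealSubfield L)) L (IsCMField.complexConj L) 3 ((StdForm.antidiagonal 3).over L)) :
      Subgroup (quasiSplit (↥(maximalRealSubfield L)) L (IsCMField.complexConj L) 3).Adelic), ∀ ψ ∈ S, ((rightTranslation (quasiSplit (↥(maximalRealSubfield L)) L (IsCMField.complexConj L) 3)).comp ((standardMaximalCompactGL 3 L).comap (adelicVal (↥(maximalRealSubfield L)) L (IsCMField.complexConj L) 3 ((StdForm.antidiagonal 3).over L)) :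
      Subgroup (quasiSplit (↥(maximalRealSubfield L)) L (IsCMField.complexConj L) 3).Adelic).subtype) k ψ ∈ S),
            φ ∈ S ∧ FiniteDimensional ℂ ↥S ∧ (Subrepresentation.toRepresentation (⟨S, hS⟩ : Subrepresentation ((rightTranslation (quasiSplit (↥(maximalRealSubfield L)) L (IsCMField.complexConj L) 3)).comp ((standardMaximalCompactGL 3 L).comap (adelicVal (↥(maximalRealSubfield L)) L (IsCMField.complexConj L) 3 ((StdForm.antidiagonal 3).over L)) :
      Subgroup (quasiSplit (↥(maximalRealSubfield L)) L (IsCMField.complexConj L) 3).Adelic).subtype))).IsIrreducible}).topologicalClosure :=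
  hW1.trans (Submodule.topologicalClosure_mono (Submodule.span_le.2 fun f hf => by
    obtain ⟨φ, hrel, hfin⟩ := hf
    exact mem_span_irrGenerators_of_kFinite L μ ξ μω hsum hrel hfin))

end Bridge

end Summit.HodgeConjecture.HodgeConjecture.R90.S8

end
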